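import Summits.ResolutionOfSingularities.ResolutionOfSingularities.Theorems.HilbertSamuelEliminationSigmaMaxModificationsCorridor3WLadderHybridLowDefs
import Summits.ResolutionOfSingularities.ResolutionOfSingularities.Theorems.HilbertSamuelEliminationSigmaMaxModificationsCorridor3WLadderHybridLowTree
import Summits.ResolutionOfSingularities.ResolutionOfSingularities.Theorems.HilbertSamuelEliminationSigmaMaxModificationsCorridor3SigmaHybridEliminationHyp
import Summits.ResolutionOfSingularities.ResolutionOfSingularities.Theorems.HilbertSamuelEliminationSigmaMaxModificationsCorridor3SigmaIsoBoundaryTransition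
import HarnessLib

/-!
# [OURS · L1 W4.2] `Corridor3WLadderHybridLow` — THE STRATEGY-GENERIC LOW (STRATA) ADAPTER: for ANY functional boundary-reading strategy with
# permissible in-stratum steps on good stages, (b)From ∧ (c-swallow)From ⇒ no moving never-isolated chain from `s₀`; with the units half as a
# binder, res-D-pv-047's E7 Low class `∀ e < N, NoMovingNearChainFromσE σ N ν s₀ (ē = e)` (RULINGS v3.14-21 (FS), v3.14-22 (FW))

Crux chain w42 (`SigmaMaxModifications`, stmt-ResolutionOfSingularities-18506; conjunct `SigmaMaxModificationsCorridor3`,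
stmt-ResolutionOfSingularities-19249). Typer res-type-040 (gen 19). Over `…WLadderHybridLowDefs` (rows `StrataBirthsSettleFromσE`,
`StrataSwallowFromσE`), `…WLadderHybridLowTree` (`eventually_unmarked_of_threads`, `eq_of_closure_image_eq_of_not_subset_support`), brick 4E
`…SigmaLocalChainsE` (`no_movingLineage_σE_of_localChains`, p532417), res-D-pv-047's E7 `…SigmaHybridEliminationHyp` (p532289: `RowsAtσE`, `RunGood`
scope) and res-type-012's `…SigmaIsoBoundary{Defs,Rows,Transition}` (`NoMovingRecurrentNearChainFromσE`, `noMovingNearChainFromσE_iff_recurrence`,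
`StepProjectionσE` API). OURS (cell res-hironaka, slot W4.2); NOT statements of H. Hironaka's manuscript [Hironaka2017] nor of [CossartJannsenSaito2020];
AI-drafted, weaker than expert review. Sorry-free PROOF file: no definition, no named fact, no binder beyond the hypotheses named in the signatures.
Helper file `--supports stmt-ResolutionOfSingularities-19249` (counted 0).

THE ARGUMENT (no labels, no cycles — replaces the label argument of stub-4's (c) ⟸ (c-geo) ∧ (c-rep) for strategies without cycle discipline).
Along a never-isolated chain `c` of σE-steps (σ functional; stages `RunGood`; steps from the chain's states with permissible centres inside the
stratum), suppose (b) holds from stage `0` (every stratum component through `x_{n+1}` dominates one through `x_n`) and (c-swallow) holds from stage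
`0` (every allowed step that blows up `x_n` has a centre containing some stratum component through `x_n`). The components through the chain points
form an `ℕ`-levelled forest with finite levels (Noetherian stages), edges = domination under the chosen step projections `f n` (blow-ups in the
presented centres `C n`); MARK a node `(n, Z)` when `Z ⊆ V(C n)`. (i) Brick 4E: along every thread the marks stop (a lineage is hit finitely often:
(T) + (K)). (ii) An unmarked node has at most one child (`…HybridLowTree` §2). (iii) Tree lemma: the marks stop globally. (iv) A late blow-up of
`x_n` (by any allowed `(D, P')`, `D = C n` by functionality) marks a node — so `x_n` is blown up finitely often: the chain is not moving.

Contents (namespace `…Theorems.SigmaMaxModificationsCorridor3.Sigma`): §1 `not_isBlownUpσE_eventually_of_births_swallow` (chain level); §2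
`noMovingNearChainFromσE_notIso_of_births_swallow` (row level, From-`s₀`); §3 the LOW JOIN `noMovingNearChainFromσE_low_of_births_swallow_units` /
`low_of_births_swallow_units` (+ the units half `NoMovingRecurrentNearChainFromσE σ N ν s₀ (ē < N) (Iso N)` as a binder, through
`noMovingNearChainFromσE_iff_recurrence`) and the ORIGIN-LEVEL form `low_init_of_births_swallow_units` under
`IsAdmissibleStrategyOnE (StrategyE.RunReachableState p σ N ν E₀) N ν σ` — the shape of E7's Low conjunct of `RowsAtσE`.

References: CJS LNM 2270 Rem. 6.29 (1), Lemma 6.30, Prop. 6.31, Thm. 6.35, p. 105, p. 107 [CossartJannsenSaito2020]; Stacks 02OS [StacksProject];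
D. Kőnig 1927; tree p500484, p526259, p529370, p530900, p532417, p532289, p528217/p529149/p529631, p523041.
-/

noncomputable section

set_option linter.dupNamespace false

open CategoryTheory CategoryTheory.Limits AlgebraicGeometry TopologicalSpace Topology IsLocalRing Order
open Summit.ResolutionOfSingularities.ResolutionOfSingularities.Theorems.CampaignW42
open Literature.AlgebraicGeometry.Resolution Literature.RingTheory.HilbertSamuel
open Literature.AlgebraicGeometry.CossartJannsenSaito2020
open Summit.ResolutionOfSingularities.ResolutionOfSingularities.Theorems.SigmaMaxModificationsCorridor3
open Summit.ResolutionOfSingularities.ResolutionOfSingularities.Theorems.SigmaMaxModificationsCorridor3.Moving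
open Scheme.IdealSheafData

namespace Summit.ResolutionOfSingularities.ResolutionOfSingularities.Theorems.SigmaMaxModificationsCorridor3.Sigma

universe u

variable {N : ℕ} {ν : ℕ → ℕ} {k : Type u} [Field k] {σ : StrategyE.{u}}

/-! ## §1. Chain level: births settled and swallowing from stage `0` ⇒ the chain point is eventually never blown up -/

/-- **(b) ∧ (c-swallow) FROM STAGE `0` ⇒ THE CHAIN POINT IS BLOWN UP ONLY FINITELY OFTEN** (never-isolated chain of σE-steps; σ functional;
good stages; steps from the chain's states with permissible centres inside the stratum; `0 < N ≤ 3`; modulo the kill row). The tree argument of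
the module docstring. [cite: CossartJannsenSaito2020, Rem. 6.29 (1), Lemma 6.30, p. 105] -/
theorem not_isBlownUpσE_eventually_of_births_swallow (hK : LocalNearPointChainsTerminate.{u}) (hN0 : 0 < N) (hN3 : N ≤ 3)
    (hσ : σ.IsFunctional N ν) {c : ℕ → MarkedStageE.{u}} (hgood : ∀ n, RunGood k N ν (c n).W)
    (hadm : ∀ n (C : (c n).W.IdealSheafData) (P' : Option (Pending (blowup C))),
      σ.step (c n).W (c n).ln N ν (c n).L (c n).P (c n).E C P' →
        IdealSheafData.IsPermissible C ∧ (C.support : Set (c n).W) ⊆ Scheme.hsStratum (c n).W N ν)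
    (hpt : ∀ n, (c n).pt ∈ Scheme.hsStratum (c n).W N ν) (hstep : ∀ n, CanonicalNearStepσE σ N ν (c n) (c (n + 1)))
    (hnot : ∀ n, ¬ Iso N (c n).toMarkedStage)
    (hb : ∀ n (f : (c (n + 1)).W ⟶ (c n).W), StepProjectionσE σ N ν (c n) (c (n + 1)) f →
      ∀ Z' ∈ componentsThrough N ν (c (n + 1)).toMarkedStage, closure (f.base '' Z') ∈ componentsIn (Scheme.hsStratum (c n).W N ν))
    (hsw : ∀ n (C : (c n).W.IdealSheafData) (P' : Option (Pending (blowup C))),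
      σ.step (c n).W (c n).ln N ν (c n).L (c n).P (c n).E C P' → (c n).pt ∈ (C.support : Set (c n).W) →
        ∃ Z ∈ componentsThrough N ν (c n).toMarkedStage, Z ⊆ (C.support : Set (c n).W)) :
    ∃ n₀, ∀ n, n₀ ≤ n → ¬ (c n).IsBlownUpσE σ N ν := by
  -- step projections, presented centres, blow-up data
  have hproj : ∀ n, ∃ f : (c (n + 1)).W ⟶ (c n).W, StepProjectionσE σ N ν (c n) (c (n + 1)) f :=
    fun n => (hstep n).exists_stepProjectionσE
  choose f hf using hproj
  have hfC : ∀ n, ∃ C : (c n).W.IdealSheafData,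
      (∃ P' : Option (Pending (blowup C)), σ.step (c n).W (c n).ln N ν (c n).L (c n).P (c n).E C P') ∧ IsBlowup (f n) C := by
    intro n
    obtain ⟨C, P', hln, x', hcs, -, -, -, e, hfe⟩ := hf n
    refine ⟨C, ⟨P', hcs⟩, ?_⟩
    rw [hfe]
    exact (blowup.isBlowup C).iso_comp (eqToIso (congrArg MarkedStage.W (congrArg MarkedStageE.toMarkedStage e)))
  choose C hC hbl using hfC
  haveI hN : ∀ n, IsNoetherian (c n).W := fun n => by
    obtain ⟨g, hg, hq⟩ := (hgood n).overField
    haveI := (c n).ln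
    exact Scheme.isNoetherian_of_finiteType_over_field g
  -- the forest of components through the chain points
  let T : ∀ n, Set (Set (c n).W) := fun n => componentsThrough N ν (c n).toMarkedStage
  have hTdom : ∀ n (Z' : ↥(T (n + 1))), closure ((f n).base '' Z'.1) ∈ T n := fun n Z' =>
    ⟨hb n (f n) (hf n) Z'.1 Z'.2, subset_closure ⟨(c (n + 1)).pt, Z'.2.2, (hf n).base_pt⟩⟩
  let V : Type u := Σ n, ↥(T n)
  let lvl : V → ℕ := fun v => v.1
  let par : V → V := fun v => match v with
    | ⟨0, Z⟩ => ⟨0, Z⟩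
    | ⟨n + 1, Z'⟩ => ⟨n, ⟨closure ((f n).base '' Z'.1), hTdom n Z'⟩⟩
  let Mk : V → Prop := fun v => (v.2.1 : Set (c v.1).W) ⊆ ((C v.1).support : Set (c v.1).W)
  haveI : ∀ n, Finite ↥(T n) := fun n => (componentsThrough_finite (N := N) (ν := ν) (c n).toMarkedStage).to_subtype
  have hfin : ∀ n, {v : V | lvl v = n}.Finite := fun n => by
    refine (Set.finite_range (fun Z : ↥(T n) => (⟨n, Z⟩ : V))).subset ?_
    rintro ⟨m, Z⟩ hm
    change m = n at hm
    subst hm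
    exact ⟨Z, rfl⟩
  have hlvl : ∀ v, 0 < lvl v → lvl (par v) + 1 = lvl v := by
    rintro ⟨_ | n, Z⟩ h
    · exact absurd h (lt_irrefl 0)
    · rfl
  have hZirr : ∀ n (Z : ↥(T n)), IsIrreducible (Z.1 : Set (c n).W) := fun n Z => componentsIn.isIrreducible Z.2.1
  have hZcl : ∀ n (Z : ↥(T n)), IsClosed (Z.1 : Set (c n).W) := fun n Z =>
    componentsIn.isClosed (hgood n).isClosed_hsStratum Z.2.1
  have hbranch : ∀ v, ¬ Mk v → ∀ w₁ w₂, par w₁ = v → par w₂ = v → lvl w₁ = lvl v + 1 → lvl w₂ = lvl v + 1 → w₁ = w₂ := by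
    rintro ⟨n, Z⟩ hMk ⟨m₁, Z₁⟩ ⟨m₂, Z₂⟩ hp₁ hp₂ hl₁ hl₂
    change m₁ = n + 1 at hl₁
    change m₂ = n + 1 at hl₂
    subst hl₁
    subst hl₂
    have hd₁ : closure ((f n).base '' Z₁.1) = Z.1 := congrArg Subtype.val (eq_of_heq (Sigma.mk.inj_iff.mp hp₁).2)
    have hd₂ : closure ((f n).base '' Z₂.1) = Z.1 := congrArg Subtype.val (eq_of_heq (Sigma.mk.inj_iff.mp hp₂).2)
    have h12 : (Z₁.1 : Set (c (n + 1)).W) = Z₂.1 :=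
      eq_of_closure_image_eq_of_not_subset_support (hbl n) (hZirr n Z) (hZcl n Z) hMk (hZirr _ Z₁) (hZcl _ Z₁)
        (hZirr _ Z₂) (hZcl _ Z₂) hd₁ hd₂
    rw [Subtype.ext h12]
  have hthread : ∀ u : ℕ → V, (∀ n, lvl (u n) = n) → (∀ n, par (u (n + 1)) = u n) → ∃ n₀, ∀ n, n₀ ≤ n → ¬ Mk (u n) := by
    intro u hul hup
    have key : ∀ n, ∃ Z : ↥(T n), u n = ⟨n, Z⟩ := fun n => by
      rcases hun : u n with ⟨m, Z⟩
      have hm : m = n := by have := hul n; rw [hun] at this; exact this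
      subst hm
      exact ⟨Z, rfl⟩
    choose Zs hZs using key
    have hdom : ∀ n, closure ((f n).base '' (Zs (n + 1)).1) = (Zs n).1 := fun n => by
      have h := hup n
      rw [hZs (n + 1), hZs n] at h
      exact congrArg Subtype.val (eq_of_heq (Sigma.mk.inj_iff.mp h).2)
    by_contra hio
    push Not at hio
    -- the lineage `Zs` would be hit infinitely often
    refine no_movingLineage_σE_of_localChains hK hN0 hN3 hσ hgood hadm hpt hnot
      ⟨fun n => (Zs n).1, fun n => (Zs n).2, fun n => ⟨f n, hf n, hdom n⟩, fun n => ?_⟩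
    obtain ⟨m, hnm, hMk⟩ := hio n
    obtain ⟨P', hcs⟩ := hC m
    refine ⟨m, hnm, C m, P', hcs, ?_⟩
    rw [hZs m] at hMk
    exact hMk
  -- the tree lemma: the marks stop globally
  obtain ⟨n₀, hn₀⟩ := eventually_unmarked_of_threads lvl par Mk hfin hlvl hbranch hthread
  refine ⟨n₀, fun n hn hbu => ?_⟩
  obtain ⟨D, P', hD, hxD⟩ := hbu
  obtain ⟨Z, hZT, hZD⟩ := hsw n D P' hD hxD
  obtain ⟨P₀, hC₀⟩ := hC n
  have hDC : D = C n := (hσ (c n).W (c n).ln (c n).L (c n).P (c n).E).1 D (C n) P' P₀ hD hC₀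
  subst hDC
  exact hn₀ ⟨n, ⟨Z, hZT⟩⟩ hn hZD

/-! ## §2. Row level: (b)From ∧ (c-swallow)From ⇒ no moving never-isolated chain from `s₀` -/

/-- **(b)From ∧ (c-swallow)From ⇒ NO MOVING NEVER-ISOLATED `G`-CHAIN FROM `s₀`** — for ANY functional boundary-reading strategy `σ`, on the
scope «every state σ-reached from `s₀` is `RunGood` and every step σ allows there has a PERMISSIBLE centre inside the stratum», `s₀.pt ∈ X(ν)`,
`0 < N ≤ 3`, modulo the kill row. [cite: CossartJannsenSaito2020, Rem. 6.29 (1), Lemma 6.30, Thm. 6.35, p. 105] -/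
theorem noMovingNearChainFromσE_notIso_of_births_swallow (hK : LocalNearPointChainsTerminate.{u}) (hN0 : 0 < N) (hN3 : N ≤ 3)
    (hσ : σ.IsFunctional N ν) {s₀ : MarkedStageE.{u}} {G : MarkedStage.{u} → Prop}
    (hgood : ∀ s, ReachesσE σ N ν s₀ s → RunGood k N ν s.W)
    (hadm : ∀ s, ReachesσE σ N ν s₀ s → ∀ (C : s.W.IdealSheafData) (P' : Option (Pending (blowup C))),
      σ.step s.W s.ln N ν s.L s.P s.E C P' → IdealSheafData.IsPermissible C ∧ (C.support : Set s.W) ⊆ Scheme.hsStratum s.W N ν)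
    (hpt₀ : s₀.pt ∈ Scheme.hsStratum s₀.W N ν)
    (hbirths : StrataBirthsSettleFromσE σ N ν s₀ G) (hswallow : StrataSwallowFromσE σ N ν s₀ G) :
    NoMovingNearChainFromσE σ N ν s₀ fun s => G s ∧ ¬ Iso N s := by
  rintro ⟨c, h0, hstep, hG, hmov⟩
  obtain ⟨n₁, hn₁⟩ := hbirths c h0 hstep (fun n => (hG n).1) (fun n => (hG n).2) hmov
  obtain ⟨n₂, hn₂⟩ := hswallow c h0 hstep (fun n => (hG n).1) (fun n => (hG n).2) hmov
  set n₃ := max n₁ n₂ with hn₃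
  have hreach : ∀ n, ReachesσE σ N ν s₀ (c n) := reachesσE_chain h0 hstep
  let c' : ℕ → MarkedStageE.{u} := fun n => c (n₃ + n)
  obtain ⟨n₀, hn₀⟩ := not_isBlownUpσE_eventually_of_births_swallow hK hN0 hN3 hσ (c := c')
    (fun n => hgood _ (hreach _)) (fun n => hadm _ (hreach _)) (fun n => pt_mem_hsStratum_of_reachesσE (hreach _) hpt₀)
    (fun n => hstep (n₃ + n)) (fun n => (hG _).2)
    (fun n g hg Z' hZ' => hn₁ (n₃ + n) (by omega) g hg Z' hZ')
    (fun n D P' hD hx => hn₂ (n₃ + n) (by omega) D P' hD hx)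
  obtain ⟨m, hm, hbu⟩ := io_shift hmov n₃ n₀
  exact hn₀ m hm hbu

/-! ## §3. The Low join: strata half (§2) + units half (binder) ⇒ E7's Low class, at `s₀` and at a maximal origin -/

/-- **THE LOW JOIN AT `s₀`**: on the scope of §2, (b)From ∧ (c-swallow)From in the W-low grade `ē < N` (strata half, §2) and the UNITS HALF as a
binder «no moving `ē < N` chain from `s₀` isolated in the Hilbert–Samuel locus infinitely often» give E7's Low class at `s₀`:
`∀ e < N, NoMovingNearChainFromσE σ N ν s₀ (ē = e)` (res-type-012's recurrence split). [cite: CossartJannsenSaito2020, Thm. 6.35, Thm. 6.40, p. 107] -/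
theorem low_of_births_swallow_units (hK : LocalNearPointChainsTerminate.{u}) (hN0 : 0 < N) (hN3 : N ≤ 3)
    (hσ : σ.IsFunctional N ν) {s₀ : MarkedStageE.{u}}
    (hgood : ∀ s, ReachesσE σ N ν s₀ s → RunGood k N ν s.W)
    (hadm : ∀ s, ReachesσE σ N ν s₀ s → ∀ (C : s.W.IdealSheafData) (P' : Option (Pending (blowup C))),
      σ.step s.W s.ln N ν s.L s.P s.E C P' → IdealSheafData.IsPermissible C ∧ (C.support : Set s.W) ⊆ Scheme.hsStratum s.W N ν)
    (hpt₀ : s₀.pt ∈ Scheme.hsStratum s₀.W N ν)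
    (hbirths : StrataBirthsSettleFromσE σ N ν s₀ fun s => s.geomDirDim < N)
    (hswallow : StrataSwallowFromσE σ N ν s₀ fun s => s.geomDirDim < N)
    (hunits : NoMovingRecurrentNearChainFromσE σ N ν s₀ (fun s => s.geomDirDim < N) fun s => Iso N s) :
    ∀ e, e < N → NoMovingNearChainFromσE σ N ν s₀ fun s => s.geomDirDim = e := by
  have hlow : NoMovingNearChainFromσE σ N ν s₀ fun s => s.geomDirDim < N :=
    (noMovingNearChainFromσE_iff_recurrence (fun s => Iso N s)).2
      ⟨noMovingNearChainFromσE_notIso_of_births_swallow hK hN0 hN3 hσ hgood hadm hpt₀ hbirths hswallow, hunits⟩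
  intro e he
  exact noMovingNearChainFromσE_mono (G' := fun s => s.geomDirDim < N) (fun s (hs : s.geomDirDim = e) => by rw [hs]; exact he) hlow

/-- **THE LOW JOIN AT A MAXIMAL ORIGIN** — the shape of E7's Low conjunct: for a functional `σ : StrategyE` ADMISSIBLE ON ITS RUN-WISE SCOPE
(`IsAdmissibleStrategyOnE (StrategyE.RunReachableState p σ N ν E₀) N ν σ` — res-L1-type-o1's menu hybrids by `isAdmissibleStrategyOnE_hybrid_plus`,
Ω⁺E), a maximal origin `x` of characteristic `p` and the initial state `s₀ = MarkedStageE.init X x (E₀ X x)`: (b)From ∧ (c-swallow)From in grade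
`ē < N` and the units binder give `∀ e < N, NoMovingNearChainFromσE σ N ν s₀ (ē = e)` (good stages by res-D-pv-047's `RunGood` propagation along the
run, p529895). [cite: CossartJannsenSaito2020, Thm. 3.10 (1), Thm. 6.35, Thm. 6.40, p. 107] -/
theorem low_init_of_births_swallow_units (hK : LocalNearPointChainsTerminate.{u}) (hN0 : 0 < N) (hN3 : N ≤ 3)
    (hσ : σ.IsFunctional N ν) {p : ℕ} {E₀ : ∀ (X : Scheme.{u}), X → Boundary X}
    (hadm : IsAdmissibleStrategyOnE (StrategyE.RunReachableState p σ N ν E₀) N ν σ)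
    {X : Scheme.{u}} [IsLocallyNoetherian X] {x : X} (hX : IsMaximalOrigin p N ν X x)
    (hbirths : StrataBirthsSettleFromσE σ N ν (MarkedStageE.init X x (E₀ X x)) fun s => s.geomDirDim < N)
    (hswallow : StrataSwallowFromσE σ N ν (MarkedStageE.init X x (E₀ X x)) fun s => s.geomDirDim < N)
    (hunits : NoMovingRecurrentNearChainFromσE σ N ν (MarkedStageE.init X x (E₀ X x)) (fun s => s.geomDirDim < N)
      fun s => Iso N s) :
    ∀ e, e < N → NoMovingNearChainFromσE σ N ν (MarkedStageE.init X x (E₀ X x)) fun s => s.geomDirDim = e := by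
  obtain ⟨k, hk, h0⟩ := RunGood.init hX
  have hperm : ∀ (W : Scheme.{u}) (hW : IsLocallyNoetherian W) (L : Labelling W) (P : Option (Pending W)) (E : Boundary W),
      StrategyE.RunReachableState p σ N ν E₀ W hW L P E →
        ∀ (C : W.IdealSheafData) (P' : Option (Pending (blowup C))), σ.step W hW N ν L P E C P' → IdealSheafData.IsPermissible C :=
    fun W hW L P E hS C P' hst => ((hadm W hW L P E hS).1 C P' hst).1
  have hscope : ∀ s : MarkedStageE.{u}, ReachesσE σ N ν (MarkedStageE.init X x (E₀ X x)) s →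
      StrategyE.RunReachableState p σ N ν E₀ s.W s.ln s.L s.P s.E := fun s hs =>
    StrategyE.reachableState_subset_runReachableState (StrategyE.reachableState_of_inScopeMσE ⟨X, inferInstance, x, hX, hs⟩)
  refine low_of_births_swallow_units (k := k) hK hN0 hN3 hσ (fun s hs => ?_) (fun s hs C P' hst => ?_) hX.mem_stratum hbirths hswallow hunits
  · exact runGood_of_stateReachesσE (t := s.toStateσE) hX h0 hperm hs.stateReachesσE
  · obtain ⟨h1, h2, -⟩ := (hadm s.W s.ln s.L s.P s.E (hscope s hs)).1 C P' hst
    exact ⟨h1, h2⟩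

end Summit.ResolutionOfSingularities.ResolutionOfSingularities.Theorems.SigmaMaxModificationsCorridor3.Sigma

end
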